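import Literature.MeasureTheory.RestrictedProduct.Borel
import Mathlib.MeasureTheory.Integral.Pi
import Mathlib.MeasureTheory.Integral.Prod
import HarnessLib

/-!
# Restricted product measures, VIII: integrals of cylinder product functions
# `∫ 1_{A_S}(x) ∏_{i∈S} f_i(x_i) dμ = ∏_{i∈S} ∫ f_i dν_i`

Topic `MeasureTheory/RestrictedProduct`; continues `ProductMeasureRestrict` (the product formula
`μ|_{A_S} = (e_S)_* ((∏_{i∈S} ν_i) ⊗ ρ_S)` for the restricted product measure `μ = rpMeasure K ν S₀`, Tate's
thesis, Cassels–Fröhlich (1967) Ch. XV §3.3 [CasselsFrohlichANT1967]). THEOREMS ONLY (no definition, no instance).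

The **Euler factorisation of integrals of factorizable functions** over a restricted product: for a finite
`S ⊇ S₀` and scalar functions `f_i : G_i → 𝕜` (`i ∈ S`), the function
`x ↦ 1_{A_S}(x) · ∏_{i∈S} f_i(x_i)` — the restricted tensor product `⊗_{i∈S} f_i ⊗ ⊗_{i∉S} 1_{K_i}` — integrates to
`∏_{i∈S} ∫ f_i dν_i` against `μ` (`integral_indicator_rpBox_prod`; no integrability hypotheses: both sides use
the Bochner integral's conventions, Mathlib `integral_fintype_prod_eq_prod`). This is the computation behind every
"`∫_{G(𝔸)} ⊗ f_v = ∏_v ∫_{G_v} f_v`" in the theory of automorphic forms (e.g. Tate's thesis, Cassels–Fröhlich Ch. XV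
§3.3 "`dα = ∏ dα_𝔭`"; Borel–Jacquet (1979) §4.1 for reductive groups; the factorisation of orbital integrals of
pure tensors).

* `integral_comp_glue_prod` — `∫ F(e_S(w, k)) d((∏ ν_i) ⊗ ρ_S) = ∫ F|_{A_S} dμ` (change of variables along the
  measurable embedding `e_S`, `rpMeasure_restrict_rpBox`);
* **`integral_indicator_rpBox_prod`** — the Euler factorisation.

## References

* J. W. S. Cassels, A. Fröhlich (eds.), *Algebraic Number Theory* (1967), Ch. XV (Tate), §3.3 [CasselsFrohlichANT1967].
* A. Borel, H. Jacquet, *Automorphic forms and automorphic representations*, PSPM 33.1 (1979), §4.1 [BorelJacquet1979].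
-/

set_option autoImplicit false

noncomputable section

open _root_.MeasureTheory Set Filter Function
open scoped RestrictedProduct ENNReal NNReal

namespace Literature.MeasureTheory.RestrictedProduct

universe u v

variable {ι : Type u} {G : ι → Type v} [∀ i, MeasurableSpace (G i)]
variable (K : ∀ i, Set (G i)) (ν : ∀ i, Measure (G i))

variable [Countable ι] [∀ i, SigmaFinite (ν i)]

/-- **Change of variables along the gluing map**: for `S ⊇ S₀`,
`∫_{A_S} F dμ = ∫ F(e_S p) d((∏_{i∈S} ν_i) ⊗ ρ_S)(p)` (`rpMeasure_restrict_rpBox`; `e_S` is a measurable embedding,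
so no measurability of `F` is needed). [cite: CasselsFrohlichANT1967, Ch. XV (Tate) §3.3, PDF pp. 352–353] -/
theorem integral_comp_glue_prod (hKne : ∀ i, (K i).Nonempty) (hKm : ∀ i, MeasurableSet (K i)) {S₀ : Finset ι}
    (hK1 : ∀ i, i ∉ S₀ → ν i (K i) = 1) {S : Finset ι} (hS : S₀ ⊆ S)
    {E : Type*} [NormedAddCommGroup E] [NormedSpace ℝ E] (F : (Πʳ i, [G i, K i]) → E) :
    ∫ p, F (glue K S p) ∂((Measure.pi fun i : {i // i ∈ S} => ν i).prod (rho K ν hKne S)) =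
      ∫ x in rpBox K S, F x ∂(rpMeasure K ν S₀) := by
  rw [rpMeasure_restrict_rpBox K ν hKne hKm hK1 hS, (measurableEmbedding_glue K hKne hKm S).integral_map]

/-- **Euler factorisation of the integral of a cylinder product function** over the restricted product
measure `μ = ∏'_i (ν_i ; K_i)`: for a finite `S ⊇ S₀` and `f_i : G_i → 𝕜`, `i ∈ S`,
`∫ 1_{A_S}(x) · ∏_{i∈S} f_i(x_i) dμ(x) = ∏_{i∈S} ∫ f_i dν_i` (the factors `i ∉ S` contribute `ν_i|_{K_i}(K_i) = 1`).
No integrability hypotheses (Bochner conventions on both sides). [cite: CasselsFrohlichANT1967, Ch. XV (Tate) §3.3, PDF pp. 352–353]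
[cite: BorelJacquet1979, §4.1] -/
theorem integral_indicator_rpBox_prod (hKne : ∀ i, (K i).Nonempty) (hKm : ∀ i, MeasurableSet (K i)) {S₀ : Finset ι}
    (hK1 : ∀ i, i ∉ S₀ → ν i (K i) = 1) {S : Finset ι} (hS : S₀ ⊆ S)
    {𝕜 : Type*} [RCLike 𝕜] (f : ∀ i : {i // i ∈ S}, G i → 𝕜) :
    ∫ x, (rpBox K S).indicator (fun x => ∏ i : {i // i ∈ S}, f i (x i)) x ∂(rpMeasure K ν S₀) =
      ∏ i : {i // i ∈ S}, ∫ y, f i y ∂(ν i) := by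
  haveI : ∀ i : {i // i ∉ S}, IsProbabilityMeasure (kap K ν hKne i) :=
    fun i => isProbabilityMeasure_kap K ν hKne hKm i
  haveI := isProbabilityMeasure_rho K ν hKne hKm S
  rw [integral_indicator (measurableSet_rpBox K hKm S), ← integral_comp_glue_prod K ν hKne hKm hK1 hS]
  have hglue : ∀ p : ((i : {i // i ∈ S}) → G i) × ((i : {i // i ∉ S}) → K i),
      (∏ i : {i // i ∈ S}, f i (glue K S p i)) = ∏ i : {i // i ∈ S}, f i (p.1 i) := by
    intro p
    refine Finset.prod_congr rfl fun i _ => ?_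
    rw [glue_apply_of_mem K S p i.2]
  simp_rw [hglue]
  have h1 := integral_fun_fst (μ := Measure.pi fun i : {i // i ∈ S} => ν i) (ν := rho K ν hKne S)
    (fun w : (i : {i // i ∈ S}) → G i => ∏ i : {i // i ∈ S}, f i (w i))
  rw [probReal_univ, one_smul, integral_fintype_prod_eq_prod] at h1
  exact h1

end Literature.MeasureTheory.RestrictedProduct

end
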